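import Literature.AlgebraicGeometry.Resolution.ResolutionOfSingularities
import Literature.AlgebraicGeometry.Resolution.Blowups
import Literature.AlgebraicGeometry.Motives.Varieties
import HarnessLib.Audit
import HarnessLib

/-!
# SandwichedSingularitiesResolution / SandwichedLocusResolution — CONJECTURES
# (obligations of ResolutionOfSingularities/ResolutionOfSingularities)

The resolution-type input of Zariski's patching, in the forms that match the WEAK resolution
statement of the summit (`Literature.AlgebraicGeometry.Resolution.ResolutionInChar p`), isolated
by the line `sandwiched-gluing` of the crux `PatchingRel` (item stmt-ResolutionOfSingularities-0642,
routes `Valuative` / `CyclicCovers`). Zariski's patching of local uniformizations into a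
resolution (Zariski 1944; Piltant 2013, Prop. 5.1 and Cor. 5.7 with `P = P_reg`) needs, beyond
relative local uniformization, ONE resolution-type input: in the proper-model form
(`Literature/AlgebraicGeometry/Resolution/ProperModelsPatching.lean`, `ProperModel.RegLeification`)
it is consumed by modifying a proper model `M`, for a morphism of proper models `φ : M → Y`, so
that it becomes regular over the open `O := Reg M ∪ φ⁻¹(Reg Y)`. That open has **sandwiched
singularities**: it is regular outside its open piece `V := φ⁻¹(Reg Y)`, and `V` is proper and
birational over the REGULAR variety `Reg Y`.

Unproven conjectures are obligations of our theories, not literature facts (human ruling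
2026-08-15), so the statements live here as `@[conjecture] def`s and nothing is asserted; users
take `(h : SandwichedLocusResolution p)` etc. This file is a conjecture LEAF (definitions, plus the one-line relation SANDᴸ ⇒ SANDʷ which is a registered stub of the crux item);
the formal relations are proved in sibling `Theorems/` files
(`SandwichedSingularitiesResolutionSlices`, `ValuativePatchingRelRegLeificationOfSandwichedLocus`,
`ValuativePatchingRelLocalRegLeificationWeak`, `ValuativePatchingRelSandwichedBridges`,
`ValuativePatchingRel`):

* `SandwichedLocusResolution p` — SANDᴸ(p), resolution of a variety OVER a sandwiched-singularity
  open: `ResolutionInChar p →` it (formal), it `→ ProperModel.RegLeification p` (directly), and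
  `Valuative.PatchingRel ↔ ∀ p prime, (LUrel_p → SANDᴸ(p))` UNCONDITIONALLY;
* `SandwichedSingularitiesResolution p` — SANDʷ(p), the absolute form (resolve a variety with
  sandwiched singularities): SANDᴸ(p) `→` SANDʷ(p), and Nagata compactification `→` SANDʷ(p) `→`
  SANDᴸ(p); the gen-0 strong atom gives it: `SandwichedStrongResolution p →` SANDʷ(p);
* `SandwichedLocusResolutionDimLe p d` / `SandwichedLocusResolutionDimGt p d` — the slices
  `dim M ≤ d` / `dim M > d` (for `d = 3`: the Cossart–Piltant range / the open residue).

## References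

* O. Zariski, *Reduction of the singularities of algebraic three dimensional varieties*,
  Ann. of Math. 45 (1944) 472–542, Fundamental Theorem p. 539.
* O. Piltant, *An axiomatic version of Zariski's patching theorem*, RACSAM 107 (2013) 91–121,
  Prop. 5.1, Cor. 5.7; p. 2 ("All of these problems are open in dimension four or more").
  [Piltant2013]
* V. Cossart, O. Piltant, *Resolution of singularities of arithmetical threefolds*, J. Algebra
  529 (2019) 268–535, Thm. 1.1. [CossartPiltant2019]
-/

-- `Summit.<Summit>.<Sub>[.Theorems]` with `Sub = Summit` (single-conjunct summit, D-0017): the duplicated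
-- namespace component is the tree layout.
set_option linter.dupNamespace false

noncomputable section

namespace Summit.ResolutionOfSingularities.ResolutionOfSingularities

open CategoryTheory AlgebraicGeometry
open Literature.AlgebraicGeometry.Resolution

universe u

/-- OPEN CONJECTURE — **SANDʷ(p), weak resolution of varieties with sandwiched singularities in
characteristic `p`**: for a field `k` of characteristic `p`, a regular integral separated
`k`-scheme of finite type `U`, an integral separated `k`-scheme of finite type `X`, an open
`V ⊆ X` such that every point of `X` outside `V` is a regular point, and a proper birational
`k`-morphism `η : V → U`, the scheme `X` admits a resolution of singularities
(`Scheme.HasResolution`: proper, birational, regular source). The case `dim X ≤ 3` is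
Cossart–Piltant 2019, Thm. 1.1 (weak form, the named fact `CossartPiltant2019`); the statement
for all dimensions is OPEN (Piltant 2013, p. 2: "All of these problems are open in dimension four
or more") [status: open]. It is implied by `ResolutionInChar p` (such an `X` is a reduced
separated `k`-scheme of finite type), so it cannot be refuted short of refuting resolution in
characteristic `p`. Posed here (line `sandwiched-gluing` of crux stmt-ResolutionOfSingularities-0642)
as the absolute form of the resolution input of Zariski's patching.
[cite: Piltant2013, p. 2 (open in dimension ≥ 4); CossartPiltant2019, Thm. 1.1 (dim ≤ 3)] -/
@[conjecture] def SandwichedSingularitiesResolution (p : ℕ) : Prop :=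
  ∀ (k : Type u) [Field k] [CharP k p] (U X : Scheme.{u}) (f : U ⟶ Spec (.of k))
    (g : X ⟶ Spec (.of k)) (V : X.Opens) (η : (V : Scheme.{u}) ⟶ U),
    IsSeparated f → LocallyOfFiniteType f → QuasiCompact f → IsIntegral U →
    Scheme.IsRegular U → IsSeparated g → LocallyOfFiniteType g → QuasiCompact g →
    IsIntegral X → IsProper η → IsBirational η → η ≫ f = V.ι ≫ g →
    (∀ x : X, x ∉ V → IsRegularLocalRing (X.presheaf.stalk x)) →
      Scheme.HasResolution X

/-- OPEN CONJECTURE — **SANDᴸ(p), resolution over a sandwiched-singularity open in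
characteristic `p`** (the resolution input of Zariski's patching in the form EQUIVALENT to the
crux `PatchingRel`, with no compactification step left over): for a field `k` of characteristic
`p`, a regular integral separated `k`-scheme of finite type `U`, an integral separated
`k`-scheme of finite type `M`, opens `V ⊆ O ⊆ M` such that every point of `O` outside `V` is a
regular point of `M`, and a proper birational `k`-morphism `η : V → U`, there is an integral
scheme `N` and a proper birational `ρ : N → M` such that every point of `N` lying over `O` is a
regular point — a resolution of `M` OVER its sandwiched-singularity open `O`, arbitrary over
`M ∖ O`. Implied by `ResolutionInChar p` (resolve `M`); for `M = O` it is SANDʷ(p); conversely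
SANDʷ(p) and Nagata compactification give it. The case `dim M ≤ 3` is `CossartPiltant2019`;
OPEN in dimension `≥ 4` (Piltant 2013, p. 2) [status: open]. Posed here (line
`sandwiched-gluing` of crux stmt-ResolutionOfSingularities-0642).
[cite: Piltant2013, p. 2 (open in dimension ≥ 4); CossartPiltant2019, Thm. 1.1 (dim ≤ 3)] -/
@[conjecture] def SandwichedLocusResolution (p : ℕ) : Prop :=
  ∀ (k : Type u) [Field k] [CharP k p] (U M : Scheme.{u}) (f : U ⟶ Spec (.of k))
    (g : M ⟶ Spec (.of k)) (O V : M.Opens) (η : (V : Scheme.{u}) ⟶ U),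
    IsSeparated f → LocallyOfFiniteType f → QuasiCompact f → IsIntegral U →
    Scheme.IsRegular U → IsSeparated g → LocallyOfFiniteType g → QuasiCompact g →
    IsIntegral M → IsProper η → IsBirational η → η ≫ f = V.ι ≫ g → V ≤ O →
    (∀ x : M, x ∈ O → x ∉ V → IsRegularLocalRing (M.presheaf.stalk x)) →
      ∃ (N : Scheme.{u}) (ρ : N ⟶ M), IsIntegral N ∧ IsProper ρ ∧ IsBirational ρ ∧
        ∀ n : N, ρ n ∈ O → IsRegularLocalRing (N.presheaf.stalk n)

/-- CONJECTURE SLICE — **SANDᴸ(p) in dimension `≤ d`**: `SandwichedLocusResolution p`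
restricted to schemes `M` of (topological Krull) dimension `≤ d`. For `d ≤ 3` it follows from the
named fact `CossartPiltant2019` (sibling file); for `d ≥ 4` it is open [status: open for d ≥ 4].
[cite: CossartPiltant2019, Thm. 1.1 (dim ≤ 3); Piltant2013, p. 2 (open in dimension ≥ 4)] -/
@[conjecture] def SandwichedLocusResolutionDimLe (p d : ℕ) : Prop :=
  ∀ (k : Type u) [Field k] [CharP k p] (U M : Scheme.{u}) (f : U ⟶ Spec (.of k))
    (g : M ⟶ Spec (.of k)) (O V : M.Opens) (η : (V : Scheme.{u}) ⟶ U),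
    IsSeparated f → LocallyOfFiniteType f → QuasiCompact f → IsIntegral U →
    Scheme.IsRegular U → IsSeparated g → LocallyOfFiniteType g → QuasiCompact g →
    IsIntegral M → IsProper η → IsBirational η → η ≫ f = V.ι ≫ g → V ≤ O →
    (∀ x : M, x ∈ O → x ∉ V → IsRegularLocalRing (M.presheaf.stalk x)) →
    topologicalKrullDim M ≤ d →
      ∃ (N : Scheme.{u}) (ρ : N ⟶ M), IsIntegral N ∧ IsProper ρ ∧ IsBirational ρ ∧
        ∀ n : N, ρ n ∈ O → IsRegularLocalRing (N.presheaf.stalk n)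

/-- OPEN CONJECTURE SLICE — **SANDᴸ(p) in dimension `> d`**: `SandwichedLocusResolution p`
restricted to schemes `M` of (topological Krull) dimension `> d`. For `d = 3` and `p` prime this
is the open residue of Zariski's patching in positive characteristic (Piltant 2013, p. 2: "All of
these problems are open in dimension four or more") [status: open].
[cite: Piltant2013, p. 2 (open in dimension ≥ 4)] -/
@[conjecture] def SandwichedLocusResolutionDimGt (p d : ℕ) : Prop :=
  ∀ (k : Type u) [Field k] [CharP k p] (U M : Scheme.{u}) (f : U ⟶ Spec (.of k))
    (g : M ⟶ Spec (.of k)) (O V : M.Opens) (η : (V : Scheme.{u}) ⟶ U),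
    IsSeparated f → LocallyOfFiniteType f → QuasiCompact f → IsIntegral U →
    Scheme.IsRegular U → IsSeparated g → LocallyOfFiniteType g → QuasiCompact g →
    IsIntegral M → IsProper η → IsBirational η → η ≫ f = V.ι ≫ g → V ≤ O →
    (∀ x : M, x ∈ O → x ∉ V → IsRegularLocalRing (M.presheaf.stalk x)) →
    (d : WithBot ℕ∞) < topologicalKrullDim M →
      ∃ (N : Scheme.{u}) (ρ : N ⟶ M), IsIntegral N ∧ IsProper ρ ∧ IsBirational ρ ∧
        ∀ n : N, ρ n ∈ O → IsRegularLocalRing (N.presheaf.stalk n)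

/-! ## The one formal relation kept in the leaf (registered stub of the crux item) -/

/-- **SANDᴸ(p) ⇒ SANDʷ(p)**: take `M = X` and `O = ⊤`; a proper birational `N → X` regular over
`⊤` is a resolution of `X`. [folklore] -/
theorem sandwichedSingularitiesResolution_of_sandwichedLocus {p : ℕ}
    (h : SandwichedLocusResolution.{u} p) : SandwichedSingularitiesResolution.{u} p := by
  intro k _ _ U X f g V η h₁ h₂ h₃ h₄ h₅ h₆ h₇ h₈ h₉ h₁₀ h₁₁ h₁₂ h₁₃
  obtain ⟨N, ρ, -, hρ, hbir, hreg⟩ :=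
    h k U X f g ⊤ V η h₁ h₂ h₃ h₄ h₅ h₆ h₇ h₈ h₉ h₁₀ h₁₁ h₁₂ le_top (fun x _ hx => h₁₃ x hx)
  exact ⟨N, ρ, ⟨hρ, hbir, fun n => hreg n trivial⟩⟩

/-- **Registered stub of line `sandwiched-gluing`** (crux stmt-ResolutionOfSingularities-0642,
universe `0`): SANDᴸ(p) ⇒ SANDʷ(p). [folklore] -/
theorem stub_sandwichedWeak_of_sandwichedLocus :
    ∀ p : ℕ, SandwichedLocusResolution.{0} p → SandwichedSingularitiesResolution.{0} p :=
  fun _ h => sandwichedSingularitiesResolution_of_sandwichedLocus h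

/-! ## v3 cut (continuation lead c1, 2026-08-16): resolution by ONE blowing up

The compactification half hidden in SANDᴸ (its absolute form SANDʷ gives it back only modulo
Nagata compactification, `Theorems/ValuativePatchingRelSandwichedBridges.lean`) is paid instead
by the FORMAT of the resolution: a blowing up `Bl_I O → O` of an open `O ⊆ M` extends to the
blowing up of `M` along the push-forward ideal `I.map O.ι`, which restricts to it over `O`
(Piltant 2013, proof of Prop. 5.1, Step 2: blow up the Zariski closure of the centre). The three
conjecture-type statements below are the v3 atom SANDᵇ(p), its dimension slice, and the format
statement for all varieties; the formal relations (`SANDᵇ ⇒ SANDᴸ`, `BlowupRes ⇒ SANDᵇ`,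
`BlowupRes ⇒ Res`, the dimension slice of the bridge, the capstone) are proved in sibling
`Theorems/` files. -/

/-- OPEN CONJECTURE — **SANDᵇ(p), resolution BY ONE BLOWING UP of varieties with sandwiched
singular locus, characteristic `p`**: for a field `k` of characteristic `p`, a regular integral
separated `k`-scheme of finite type `U`, an integral separated `k`-scheme of finite type `X`, an
open `V ⊆ X` such that every point of `X` outside `V` is a regular point, and a proper birational
`k`-morphism `η : V → U`, there is a non-zero (quasi-coherent) ideal sheaf `I` on `X` whose
blowing up `Bl_I X` is a regular scheme. Same hypotheses as SANDʷ(p)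
(`SandwichedSingularitiesResolution p`), conclusion in the format in which resolution theorems are
proved (Hironaka 1964, Cossart–Jannsen–Saito 2020, Cossart–Piltant 2008/2009: composites of
blowing ups; a composite of blowing ups of a variety is one blowing up, and for `X`
quasi-projective "resolution by a blowing up" = "resolution `X' → X` with `X' → X` projective",
Hartshorne II.7.17). It implies SANDᴸ(p) with no compactification theorem and is implied by
`BlowupResolutionInChar p`; it is NOT formally implied by `ResolutionInChar p` (weak resolutions
need not be blowings up). OPEN in dimension `≥ 4` (Piltant 2013, p. 2) [status: open]. Posed here
(line `sandwiched-gluing`, v3 cut, of crux stmt-ResolutionOfSingularities-0642).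
[cite: Piltant2013, p. 2 (open in dimension ≥ 4) and Prop. 5.1 (proof, Step 2)] -/
@[conjecture] def SandwichedBlowupResolution (p : ℕ) : Prop :=
  ∀ (k : Type u) [Field k] [CharP k p] (U X : Scheme.{u}) (f : U ⟶ Spec (.of k))
    (g : X ⟶ Spec (.of k)) (V : X.Opens) (η : (V : Scheme.{u}) ⟶ U),
    IsSeparated f → LocallyOfFiniteType f → QuasiCompact f → IsIntegral U →
    Scheme.IsRegular U → IsSeparated g → LocallyOfFiniteType g → QuasiCompact g →
    IsIntegral X → IsProper η → IsBirational η → η ≫ f = V.ι ≫ g →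
    (∀ x : X, x ∉ V → IsRegularLocalRing (X.presheaf.stalk x)) →
      ∃ (I : X.IdealSheafData) (X' : Scheme.{u}) (π : X' ⟶ X),
        I ≠ ⊥ ∧ IsBlowup π I ∧ Scheme.IsRegular X'

/-- OPEN CONJECTURE SLICE — **SANDᵇ(p) in dimension `> d`**: `SandwichedBlowupResolution p`
restricted to schemes `X` of (topological Krull) dimension `> d`; for `d = 3` and `p` prime the
open residue (Piltant 2013, p. 2: "All of these problems are open in dimension four or more")
[status: open]. [cite: Piltant2013, p. 2 (open in dimension ≥ 4)] -/
@[conjecture] def SandwichedBlowupResolutionDimGt (p d : ℕ) : Prop :=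
  ∀ (k : Type u) [Field k] [CharP k p] (U X : Scheme.{u}) (f : U ⟶ Spec (.of k))
    (g : X ⟶ Spec (.of k)) (V : X.Opens) (η : (V : Scheme.{u}) ⟶ U),
    IsSeparated f → LocallyOfFiniteType f → QuasiCompact f → IsIntegral U →
    Scheme.IsRegular U → IsSeparated g → LocallyOfFiniteType g → QuasiCompact g →
    IsIntegral X → IsProper η → IsBirational η → η ≫ f = V.ι ≫ g →
    (∀ x : X, x ∉ V → IsRegularLocalRing (X.presheaf.stalk x)) →
    (d : WithBot ℕ∞) < topologicalKrullDim X →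
      ∃ (I : X.IdealSheafData) (X' : Scheme.{u}) (π : X' ⟶ X),
        I ≠ ⊥ ∧ IsBlowup π I ∧ Scheme.IsRegular X'

/-- OPEN CONJECTURE — **resolution by one blowing up in characteristic `p`**: every integral
separated scheme of finite type `X` over a field of characteristic `p` carries a non-zero ideal
sheaf `I` whose blowing up `Bl_I X` is regular. For `p = 0` this is Hironaka's theorem in the
form in which it is proved (Main Theorem I: a composite of blowing ups with regular centres; a
composite of blowing ups of a variety is a blowing up); for `p` prime it is known in dimension
`≤ 2` (Cossart–Jannsen–Saito 2020, Thm. 1.2: a composite of permissible blowing ups) and OPEN in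
general [status: open]. It implies `ResolutionInChar p` and SANDᵇ(p); it is not formally implied
by `ResolutionInChar p`. [cite: Piltant2013, p. 2 (open in dimension ≥ 4)] -/
@[conjecture] def BlowupResolutionInChar (p : ℕ) : Prop :=
  ∀ (k : Type u) [Field k] [CharP k p] (X : Scheme.{u}) (g : X ⟶ Spec (.of k)),
    IsSeparated g → LocallyOfFiniteType g → QuasiCompact g → IsIntegral X →
      ∃ (I : X.IdealSheafData) (X' : Scheme.{u}) (π : X' ⟶ X),
        I ≠ ⊥ ∧ IsBlowup π I ∧ Scheme.IsRegular X'

/-- **SANDᵇ(p) is the conjunction-free restriction of `BlowupResolutionInChar p`** to the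
sandwiched class: the scheme `X` of SANDᵇ is an integral separated `k`-scheme of finite type.
[folklore] -/
theorem sandwichedBlowupResolution_of_blowupResolutionInChar {p : ℕ}
    (h : BlowupResolutionInChar.{u} p) : SandwichedBlowupResolution.{u} p :=
  fun k _ _ _ X _ g _ _ _ _ _ _ _ hg₁ hg₂ hg₃ hX _ _ _ _ => h k X g hg₁ hg₂ hg₃ hX

/-- **Registered stub B3 of line `sandwiched-gluing` (v3 cut)** (crux
stmt-ResolutionOfSingularities-0642, universe `0`): `BlowupResolutionInChar p ⇒` SANDᵇ(p).
[folklore] -/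
theorem stub_sandwichedBlowup_of_blowupResolutionInChar :
    ∀ p : ℕ, BlowupResolutionInChar.{0} p → SandwichedBlowupResolution.{0} p :=
  fun _ h => sandwichedBlowupResolution_of_blowupResolutionInChar h

/-- SANDᵇ(p) gives its dimension-`> d` slice. [folklore] -/
theorem sandwichedBlowupResolutionDimGt_of_sandwichedBlowupResolution {p : ℕ}
    (h : SandwichedBlowupResolution.{u} p) (d : ℕ) : SandwichedBlowupResolutionDimGt.{u} p d :=
  fun k _ _ U X f g V η h₁ h₂ h₃ h₄ h₅ h₆ h₇ h₈ h₉ h₁₀ h₁₁ h₁₂ h₁₃ _ =>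
    h k U X f g V η h₁ h₂ h₃ h₄ h₅ h₆ h₇ h₈ h₉ h₁₀ h₁₁ h₁₂ h₁₃

/-! ## v3 cut, strong form: Sing-admissible blowing ups of the sandwiched PIECE

The statements above (SANDᴸ, SANDʷ, SANDᵇ) are about a variety `X` which is regular off a
sandwiched open piece `V`. The cleanest absolute statements are about the sandwiched variety `V`
ALONE. In the weak format a resolution of `V` does not extend over `X ∖ V ⊆ Reg X` (that is the
gluing / compactification problem of the gen-0 cut); in the format of a blowing up along an ideal
sheaf `J` whose cosupport `V(J)` lies in the singular locus of `V` it does, for free: `Sing V =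
Sing X ∩ V` is CLOSED in `X` (the regular locus of a scheme locally of finite type over a field is
open), so `V(J)` is closed in `X`, the push-forward ideal `J.map V.ι` has the same cosupport, and
its blowing up is `Bl_J V` over `V` and an isomorphism over `X ∖ V(J) ⊇ X ∖ V ⊆ Reg X`. Hence the
strong blow-up form SAND⁺ᵇ(p) below implies SANDᵇ(p) (sibling file
`Theorems/ValuativePatchingRelStrongBlowup.lean`), and Zariski's patching needs, in this format,
no compactification, no gluing, no bad points and no lower-dimensional input. -/

/-- OPEN CONJECTURE — **SAND⁺ᵇ(p), Sing-admissible blow-up desingularization of SANDWICHED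
varieties in characteristic `p`**: for a field `k` of characteristic `p`, a regular integral
separated `k`-scheme of finite type `U` and an integral scheme `V` proper and birational over `U`
(a *sandwiched* variety: a modification of a regular variety), there is a non-zero ideal sheaf `J`
on `V`, whose cosupport consists of singular points of `V`, such that the blowing up `Bl_J V` is
regular. Same hypotheses as the gen-0 atom `Literature.AlgebraicGeometry.Resolution.SandwichedStrongResolution p`
(strong resolution of sandwiched varieties: an abstract proper birational `π` from a regular
scheme, an isomorphism over `Reg V`), conclusion in blow-up format (so SAND⁺ᵇ(p) ⇒ SAND⁺(p):
`Bl_J V → V` is an isomorphism off `V(J) ⊆ Sing V`). This is the format in which strong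
resolution theorems are proved (Hironaka 1964 / Bierstone–Milman: blowing ups with smooth
centres over the singular locus; Cossart–Jannsen–Saito 2020, Thm. 1.2, dimension `≤ 2`: "the
blow-up of `X_i` in a permissible center `D_i ⊂ X_i` which is contained in `(X_i)_sing`"). It
contains the strong resolution of every blowing up `Bl_I U` of every regular variety `U`
(Piltant's Axiom 4 on regular varieties). OPEN in dimension `≥ 4` (Piltant 2013, p. 2)
[status: open]. Posed here (line `sandwiched-gluing`, v3 cut, of crux
stmt-ResolutionOfSingularities-0642). [cite: Piltant2013, p. 2 (open in dimension ≥ 4)]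
[cite: CossartJannsenSaito2020, Thm. 1.2 (the format, dimension ≤ 2)] -/
@[conjecture] def SandwichedStrongBlowupResolution (p : ℕ) : Prop :=
  ∀ (k : Type u) [Field k] [CharP k p] (U V : Scheme.{u}) (f : U ⟶ Spec (.of k)) (η : V ⟶ U),
    IsSeparated f → LocallyOfFiniteType f → QuasiCompact f → IsIntegral U →
    Scheme.IsRegular U → IsIntegral V → IsProper η → IsBirational η →
      ∃ (J : V.IdealSheafData) (V' : Scheme.{u}) (π : V' ⟶ V),
        J ≠ ⊥ ∧ (∀ x : V, x ∈ J.support → ¬ IsRegularLocalRing (V.presheaf.stalk x)) ∧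
          IsBlowup π J ∧ Scheme.IsRegular V'

/-- OPEN CONJECTURE — **strong resolution by one Sing-admissible blowing up in characteristic
`p`**: every integral separated scheme of finite type `X` over a field of characteristic `p`
carries a non-zero ideal sheaf `J`, whose cosupport consists of singular points of `X`, such that
`Bl_J X` is regular. For `p = 0` this is Hironaka's theorem in the form in which it is proved; for
`p` prime it is known in dimension `≤ 2` (Cossart–Jannsen–Saito 2020, Thm. 1.2, as printed) and
OPEN in general [status: open]. It implies `BlowupResolutionInChar p`, SAND⁺ᵇ(p) and the gen-0
strong atom. [cite: CossartJannsenSaito2020, Thm. 1.2 (dimension ≤ 2)]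
[cite: Piltant2013, p. 2 (open in dimension ≥ 4)] -/
@[conjecture] def StrongBlowupResolutionInChar (p : ℕ) : Prop :=
  ∀ (k : Type u) [Field k] [CharP k p] (X : Scheme.{u}) (g : X ⟶ Spec (.of k)),
    IsSeparated g → LocallyOfFiniteType g → QuasiCompact g → IsIntegral X →
      ∃ (J : X.IdealSheafData) (X' : Scheme.{u}) (π : X' ⟶ X),
        J ≠ ⊥ ∧ (∀ x : X, x ∈ J.support → ¬ IsRegularLocalRing (X.presheaf.stalk x)) ∧
          IsBlowup π J ∧ Scheme.IsRegular X'

/-- The strong format statement gives the weak one (forget the cosupport condition). [folklore] -/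
theorem blowupResolutionInChar_of_strongBlowupResolutionInChar {p : ℕ}
    (h : StrongBlowupResolutionInChar.{u} p) : BlowupResolutionInChar.{u} p := by
  intro k _ _ X g hg₁ hg₂ hg₃ hX
  obtain ⟨J, X', π, hJ, -, hπ, hreg⟩ := h k X g hg₁ hg₂ hg₃ hX
  exact ⟨J, X', π, hJ, hπ, hreg⟩

/-- **`StrongBlowupResolutionInChar p ⇒` SAND⁺ᵇ(p)**: a sandwiched variety `V` (proper over a
separated finite-type `U`) is an integral separated `k`-scheme of finite type. [folklore] -/
theorem sandwichedStrongBlowupResolution_of_strongBlowupResolutionInChar {p : ℕ}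
    (h : StrongBlowupResolutionInChar.{u} p) : SandwichedStrongBlowupResolution.{u} p := by
  intro k _ _ U V f η hf₁ hf₂ hf₃ _ _ hV hη _
  haveI := hf₁; haveI := hf₂; haveI := hf₃; haveI := hη
  exact h k V (η ≫ f) inferInstance inferInstance inferInstance hV

/-! ## v3 cut, QUASI-PROJECTIVE forms (cycle 2; refuter drefute g4's mitigation (b))

For a QUASI-PROJECTIVE variety `X` over `k`, "`X` is desingularised by one blowing up" is the same
as "`X` has a resolution `X' → X` with `X' → X` projective" (Liu 2002, Thm. 8.1.24 = Hartshorne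
II.7.17: a projective birational morphism of integral schemes onto a scheme quasi-projective
over an affine Noetherian base is a blowing up), the format in which Cossart–Piltant 2008/2009,
Cossart–Jannsen–Saito 2020 and every Hironaka-style theorem are stated; for non-quasi-projective
`X` the blow-up format is formally stronger (no ample sheaf to clear denominators). The atoms
below restrict SANDᵇ / SAND⁺ᵇ to quasi-projective schemes; the line runs with them because
Zariski's patching can be done with PROJECTIVE models throughout
(`resolutionInChar_of_twoModelPatching_of_relLU`): the sandwiched-singularity open `O ⊆ M` of a
projective model is quasi-projective, and the extended blowing up `Bl_{I.map O.ι} M` is again a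
projective model (`IsBlowup.isProjectiveOver`). Quasi-projectivity over `k` is stated as "an
open `k`-immersion into a `k`-scheme projective over `k`"
(`Literature.AlgebraicGeometry.Motives.IsProjectiveOver`). -/

/-- OPEN CONJECTURE — **SANDᵇ_qp(p)**: `SandwichedBlowupResolution p` for QUASI-PROJECTIVE `X`
(an open `k`-immersion `j : X → P` into a `k`-scheme `P` projective over `k`). For such `X` the
conclusion "`Bl_I X` regular for some `I ≠ 0`" is equivalent to "`X` has a resolution `X' → X`
with `X' → X` projective" (Liu 2002, Thm. 8.1.24), so this is resolution of quasi-projective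
varieties with sandwiched singular locus in the format of the literature, with no format slack.
OPEN in dimension `≥ 4` (Piltant 2013, p. 2) [status: open]. Posed here (line `sandwiched-gluing`,
v3 cut, quasi-projective branch, of crux stmt-ResolutionOfSingularities-0642).
[cite: Piltant2013, p. 2 (open in dimension ≥ 4)] [cite: Liu2002, Thm. 8.1.24 (blow-up = projective birational, quasi-projective case)] -/
@[conjecture] def SandwichedBlowupResolutionQProj (p : ℕ) : Prop :=
  ∀ (k : Type u) [Field k] [CharP k p] (U X : Scheme.{u}) (f : U ⟶ Spec (.of k))
    (g : X ⟶ Spec (.of k)) (V : X.Opens) (η : (V : Scheme.{u}) ⟶ U),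
    IsSeparated f → LocallyOfFiniteType f → QuasiCompact f → IsIntegral U →
    Scheme.IsRegular U → IsSeparated g → LocallyOfFiniteType g → QuasiCompact g →
    IsIntegral X → IsProper η → IsBirational η → η ≫ f = V.ι ≫ g →
    (∀ x : X, x ∉ V → IsRegularLocalRing (X.presheaf.stalk x)) →
    (∃ (P : Scheme.{u}) (πP : P ⟶ Spec (.of k)) (j : X ⟶ P),
      Literature.AlgebraicGeometry.Motives.IsProjectiveOver (Over.mk πP) ∧
        IsOpenImmersion j ∧ j ≫ πP = g) →
      ∃ (I : X.IdealSheafData) (X' : Scheme.{u}) (π : X' ⟶ X),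
        I ≠ ⊥ ∧ IsBlowup π I ∧ Scheme.IsRegular X'

/-- OPEN CONJECTURE — **SAND⁺ᵇ_qp(p)**: `SandwichedStrongBlowupResolution p` for QUASI-PROJECTIVE
sandwiched varieties `V` (an open `k`-immersion of `V` into a `k`-scheme projective over `k`,
compatible with the structure map `η ≫ f`): such a `V` admits a blowing up `Bl_J V`, `J ≠ 0`
cosupported in the singular locus, with regular source — for quasi-projective `V` the format in
which strong resolution theorems are stated (a projective resolution which is an isomorphism over
`Reg V`, given as a blowing up of a `Reg V`-admissible ideal). OPEN in dimension `≥ 4`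
(Piltant 2013, p. 2) [status: open]. [cite: Piltant2013, p. 2 (open in dimension ≥ 4)]
[cite: Liu2002, Thm. 8.1.24 (blow-up = projective birational, quasi-projective case)] -/
@[conjecture] def SandwichedStrongBlowupResolutionQProj (p : ℕ) : Prop :=
  ∀ (k : Type u) [Field k] [CharP k p] (U V : Scheme.{u}) (f : U ⟶ Spec (.of k)) (η : V ⟶ U),
    IsSeparated f → LocallyOfFiniteType f → QuasiCompact f → IsIntegral U →
    Scheme.IsRegular U → IsIntegral V → IsProper η → IsBirational η →
    (∃ (P : Scheme.{u}) (πP : P ⟶ Spec (.of k)) (j : V ⟶ P),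
      Literature.AlgebraicGeometry.Motives.IsProjectiveOver (Over.mk πP) ∧
        IsOpenImmersion j ∧ j ≫ πP = η ≫ f) →
      ∃ (J : V.IdealSheafData) (V' : Scheme.{u}) (π : V' ⟶ V),
        J ≠ ⊥ ∧ (∀ x : V, x ∈ J.support → ¬ IsRegularLocalRing (V.presheaf.stalk x)) ∧
          IsBlowup π J ∧ Scheme.IsRegular V'

/-- SANDᵇ(p) gives its quasi-projective restriction (forget the embedding). [folklore] -/
theorem sandwichedBlowupResolutionQProj_of_sandwichedBlowupResolution {p : ℕ}
    (h : SandwichedBlowupResolution.{u} p) : SandwichedBlowupResolutionQProj.{u} p :=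
  fun k _ _ U X f g V η h₁ h₂ h₃ h₄ h₅ h₆ h₇ h₈ h₉ h₁₀ h₁₁ h₁₂ h₁₃ _ =>
    h k U X f g V η h₁ h₂ h₃ h₄ h₅ h₆ h₇ h₈ h₉ h₁₀ h₁₁ h₁₂ h₁₃

/-- SAND⁺ᵇ(p) gives its quasi-projective restriction (forget the embedding). [folklore] -/
theorem sandwichedStrongBlowupResolutionQProj_of_sandwichedStrongBlowupResolution {p : ℕ}
    (h : SandwichedStrongBlowupResolution.{u} p) : SandwichedStrongBlowupResolutionQProj.{u} p :=
  fun k _ _ U V f η h₁ h₂ h₃ h₄ h₅ h₆ h₇ h₈ _ => h k U V f η h₁ h₂ h₃ h₄ h₅ h₆ h₇ h₈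

end Summit.ResolutionOfSingularities.ResolutionOfSingularities


end
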